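import Summits.CriticalPhenomena.PercolationContinuityZ3.Theorems.PercNearOneGluingNoHeavyLowerTailSahiCTCLadderRowOneT
import HarnessLib

/-!
# `NoHeavyLowerTail` (crux stmt-CriticalPhenomena-4575), P3 lane: status of the ladder `(L_t)` for general `t` after gen 26

Support file (seat `prim-l12-p3`, gen 26; `--supports stmt-CriticalPhenomena-4575`).  One consolidating theorem for every level `t ≥ 2`:
for `t`-live up-sets `𝒳, 𝒵` the coefficient of `L_t = e_t·(Π·GF(𝒳∩𝒵) − GF 𝒳·GF 𝒵) − Θ_{t−1}·e_{≥t}·GF((𝒳∩𝒵)_t)` at a profile `m` is ≥ 0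
whenever `m` lies outside the middle rows `2 ≤ #dbl m ≤ 2t−2`: an exponent ≥ 4 (`coeff_ladder_eq_zero_of_four_le`), no doubled point
(`coeff_ladder_sqfree_nonneg`), one doubled point and `τ ≥ 3t−2` (`coeff_ladder_rowOneT_nonneg`, PINNED density), or at least `2t−1`
doubled points (`coeff_ladder_topRow_nonneg`, `coeff_ladder_manyDoubled_nonneg`), all with exponents ≤ 2 (exponent 3 reduces to `(L_{t−1})`,
`coeff_ladder_nonneg_of_triple`).  Memo g26 §4.15 records why the middle rows `t ≤ #dbl ≤ 2t−2` need more than the density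
inequalities.  Nothing is asserted about the crux.
-/

namespace Summit.CriticalPhenomena.PercolationContinuityZ3.Theorems.SahiCTCForms

open Finset MvPolynomial SahiCTCGenFun SahiCTCWeightedLYM

variable {α : Type*} [DecidableEq α] [Fintype α]

/-- **`(L_t)` outside the middle rows** (every `t ≥ 2`): for `t`-live up-sets and a profile `m` with an exponent ≥ 4, or with all
exponents ≤ 2 and `#dbl m ∉ [2, 2t−2]` (with `#(lev m 1) ≥ 3t − 2` when `#dbl m = 1`), the `m`-coefficient of `L_t` is ≥ 0. [this work] -/
theorem coeff_ladder_nonneg_of_settled_rowT {𝒳 𝒵 : Finset (Finset α)} (h𝒳 : IsUpperSet (𝒳 : Set (Finset α)))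
    (h𝒵 : IsUpperSet (𝒵 : Set (Finset α))) {t : ℕ} (ht : 2 ≤ t) (hXt : ∀ S ∈ 𝒳, t ≤ #S) (hZt : ∀ S ∈ 𝒵, t ≤ #S) (m : α →₀ ℕ)
    (hrow : (∃ i, 4 ≤ m i) ∨ ((∀ i, m i ≤ 2) ∧ (#(dbl m) = 0 ∨ (#(dbl m) = 1 ∧ 3 * t - 2 ≤ #(lev m 1)) ∨ 2 * t - 1 ≤ #(dbl m)))) :
    0 ≤ (ee t * (PiP * gf (𝒳 ∩ 𝒵) - gf 𝒳 * gf 𝒵) -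
      gf (bySize (· ≤ t - 1) : Finset (Finset α)) * gf (bySize (t ≤ ·) : Finset (Finset α)) *
        gf ((𝒳 ∩ 𝒵).filter fun S => #S = t)).coeff m := by
  rcases hrow with ⟨i, hi⟩ | ⟨hm, hD⟩
  · rw [coeff_ladder_eq_zero_of_four_le hi]
  rcases hD with hD0 | ⟨hD1, hτ⟩ | hDtop
  · -- no doubled point: m is the indicator of its support
    have hm1 : ∀ i, m i ≤ 1 := fun i => by
      have h2 := hm i
      by_contra h
      have hi2 : m i = 2 := by omega
      have : i ∈ dbl m := by
        unfold dbl; rw [mem_filter, Finsupp.mem_support_iff]; exact ⟨by omega, hi2⟩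
      rw [card_eq_zero.1 hD0] at this; exact notMem_empty i this
    have hmi : m = ind m.support := by
      ext i
      rw [ind_apply]
      have := hm1 i
      by_cases h : i ∈ m.support
      · rw [if_pos h]; have h' := Finsupp.mem_support_iff.1 h; omega
      · rw [if_neg h]; exact Finsupp.notMem_support_iff.1 h
    rw [hmi]
    exact coeff_ladder_sqfree_nonneg h𝒳 h𝒵 (by omega) hXt hZt _
  · exact coeff_ladder_rowOneT_nonneg h𝒳 h𝒵 ht hXt hZt hm hD1 hτ
  · by_cases htop : #(dbl m) = 2 * t - 1
    · exact coeff_ladder_topRow_nonneg h𝒳 h𝒵 (by omega) hXt hZt hm htop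
    · exact coeff_ladder_manyDoubled_nonneg h𝒳 h𝒵 (by omega) hm (by omega)

end Summit.CriticalPhenomena.PercolationContinuityZ3.Theorems.SahiCTCForms
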